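import Summits.ResolutionOfSingularities.ResolutionOfSingularities.Theorems.FrobeniusClosingPatchingRelPerfectDepthMixedDictionaryStep
import HarnessLib

/-!
# Crux `PatchingRelPerfect` (stmt-ResolutionOfSingularities-16161), chain w52 — R4ˢ-general support:
# the MULTI-CARRIER END of the mixed engine

[OURS · L1 W5.2 · rung tool] In the mixed (weight-deficient) regime of rung R4 the X-side ideal `K` carries a monomial
contact with SEVERAL carriers at once — the strict transform `E'` of the exceptional divisor and the exceptional
carriers `G_k` of the weight-deficient steps (res-L1-w52-plan-1 KERNEL NOTE v1.6; host side `DepthOne.dictionaryStep_mixed`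
p502493, `DepthOne.recarrier_of_dictionaryStep_mixed` p505434, res-D-pv-052's `DepthTargets.DepthInvariantMono` p504758):
`∏_k 𝓘_{G_k}^{w_k} ≤ K`. This file proves the END of such a process, fact-free and in any dimension:
* `support_prod_pow_subset_biUnion` — the cosupport of a finite product `∏_{k ∈ s} J_k^{w_k}` lies in the union
  of the cosupports of the `J_k`;
* `support_subset_biUnion_range_of_prod_ker_pow_le` — if `∏_{k ∈ s} (ker j_k)^{w_k} ≤ K` for closed immersions
  `j_k : G_k ⟶ X`, then `Supp K ⊆ ⋃_{k ∈ s} j_k(G_k)`: the cosupport lives on the carriers;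
* **`eq_top_of_forall_comap_eq_top`** — if moreover EVERY carrier sees the unit ideal, `K|_{G_k} = ⊤` for all
  `k ∈ s` (all E-side data resolved), then `K = ⊤` — so the FORMAT `I𝒪_X = M · K` collapses to the invertible `M`
  and D5 `TowerContraction` applies. One carrier: res-D-pv-055's `eq_top_of_ker_pow_le_of_comap_eq_top` (p498490);
  one carrier plus an opaque monomial: `support_subset_of_mul_ker_pow_le_of_comap_eq_top` (p502493).
* `eq_top_of_support_subset_of_forall_comap_eq_top` — the same with the carriers given only through a cover of
  `Supp K` by images of closed immersions.
Nothing here is a statement of the manuscript under review.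

## References
* U. Görtz, T. Wedhorn, *Algebraic Geometry I*, 2nd ed. (2020), (13.19) p. 414, Def. 13.90. [GortzWedhorn2020]
* E. Bierstone, D. Grigoriev, P. Milman, J. Włodarczyk (2011), §3.2, §4 Step 2b (monomial part). [BierstoneGrigorievMilmanWlodarczyk2011]
-/

-- `Summit.<Summit>.<Sub>.Theorems` with `Sub = Summit` (single-conjunct summit, D-0017)
set_option linter.dupNamespace false

noncomputable section

open CategoryTheory CategoryTheory.Limits AlgebraicGeometry TopologicalSpace
open Literature.AlgebraicGeometry.Resolution

namespace Summit.ResolutionOfSingularities.ResolutionOfSingularities.Theorems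

universe u v

namespace DepthOne

/-! ## §1 Cosupport of a finite product of powers -/

/-- **The cosupport of `∏_{k ∈ s} J_k^{w_k}` lies in `⋃_{k ∈ s} Supp J_k`.** [folklore] -/
theorem support_prod_pow_subset_biUnion {X : Scheme.{u}} {ι : Type v} (s : Finset ι)
    (J : ι → X.IdealSheafData) (w : ι → ℕ) :
    ((∏ k ∈ s, J k ^ w k).support : Set X) ⊆ ⋃ k ∈ s, ((J k).support : Set X) := by
  classical
  induction s using Finset.induction_on with
  | empty =>
      intro x hx
      rw [Finset.prod_empty, Scheme.IdealSheafData.one_eq_top, Scheme.IdealSheafData.support_top] at hx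
      exact absurd hx id
  | insert a s ha ih =>
      intro x hx
      rw [Finset.prod_insert ha, Scheme.IdealSheafData.support_mul, TopologicalSpace.Closeds.coe_sup] at hx
      simp only [Finset.mem_insert, Set.mem_iUnion, exists_prop]
      rcases hx with hxa | hxs
      · refine ⟨a, Or.inl rfl, ?_⟩
        rcases Nat.eq_zero_or_pos (w a) with h0 | hpos
        · rw [h0, pow_zero, Scheme.IdealSheafData.one_eq_top, Scheme.IdealSheafData.support_top] at hxa
          exact absurd hxa id
        · rwa [Scheme.IdealSheafData.support_pow _ _ hpos.ne'] at hxa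
      · have h := ih hxs
        simp only [Set.mem_iUnion, exists_prop] at h
        obtain ⟨k, hk, hxk⟩ := h
        exact ⟨k, Or.inr hk, hxk⟩

/-! ## §2 The cosupport lives on the carriers -/

/-- **If `∏_{k ∈ s} (ker j_k)^{w_k} ≤ K` for closed immersions `j_k : G_k ⟶ X`, then `Supp K ⊆ ⋃_{k ∈ s} j_k(G_k)`.**
(`Supp (ker j_k) = j_k(G_k)`, the image of a closed immersion being closed.) [cite: GortzWedhorn2020, (13.19) p. 414] -/
theorem support_subset_biUnion_range_of_prod_ker_pow_le {X : Scheme.{u}} {ι : Type v} (s : Finset ι)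
    {G : ι → Scheme.{u}} (j : ∀ k, G k ⟶ X) [∀ k, IsClosedImmersion (j k)] (w : ι → ℕ)
    {K : X.IdealSheafData} (hle : (∏ k ∈ s, (j k).ker ^ w k) ≤ K) :
    (K.support : Set X) ⊆ ⋃ k ∈ s, Set.range (j k).base := by
  intro x hx
  have h1 := support_prod_pow_subset_biUnion s (fun k => (j k).ker) w
    (Scheme.IdealSheafData.support_antitone hle hx)
  simp only [Set.mem_iUnion, exists_prop] at h1 ⊢
  obtain ⟨k, hk, hxk⟩ := h1
  refine ⟨k, hk, ?_⟩
  rwa [Scheme.Hom.support_ker, (j k).isClosedEmbedding.isClosed_range.closure_eq] at hxk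

/-! ## §3 All carriers resolved ⇒ the ideal is trivial -/

/-- **Cover form**: if `Supp K` is covered by the images of closed immersions `j_k : G_k ⟶ X` (`k ∈ s`) and
`K|_{G_k} = ⊤` for every `k ∈ s`, then `K = ⊤`. [cite: GortzWedhorn2020, (13.19) p. 414] -/
theorem eq_top_of_support_subset_of_forall_comap_eq_top {X : Scheme.{u}} {ι : Type v} (s : Finset ι)
    {G : ι → Scheme.{u}} (j : ∀ k, G k ⟶ X)
    {K : X.IdealSheafData} (hsupp : (K.support : Set X) ⊆ ⋃ k ∈ s, Set.range (j k).base)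
    (hcomap : ∀ k ∈ s, K.comap (j k) = ⊤) : K = ⊤ := by
  rw [← Scheme.IdealSheafData.support_eq_bot_iff, eq_bot_iff]
  intro x hx
  have h := hsupp hx
  simp only [Set.mem_iUnion, exists_prop] at h
  obtain ⟨k, hk, y, rfl⟩ := h
  have hy : y ∈ ((K.comap (j k)).support : Set (G k)) := by
    rw [Scheme.IdealSheafData.support_comap]
    exact hx
  rw [hcomap k hk, Scheme.IdealSheafData.support_top] at hy
  exact hy

/-- **MULTI-CARRIER END.** If the X-side ideal `K` carries the monomial contact `∏_{k ∈ s} (ker j_k)^{w_k} ≤ K` with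
respect to a finite family of carriers `j_k : G_k ⟶ X` (closed immersions; in rung R4: the strict transform of the
exceptional divisor with weight `ℓ` and the exceptional carriers of the weight-deficient steps with their weights), and
EVERY carrier sees the unit ideal, `K|_{G_k} = ⊤` (all E-side data resolved), then `K = ⊤` — the FORMAT
`I𝒪_X = M · K` is the invertible `M`, and D5 `TowerContraction` finishes. [cite: GortzWedhorn2020, (13.19) p. 414, Def. 13.90]
[cite: BierstoneGrigorievMilmanWlodarczyk2011, §4 Step 2b] -/
theorem eq_top_of_forall_comap_eq_top {X : Scheme.{u}} {ι : Type v} (s : Finset ι)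
    {G : ι → Scheme.{u}} (j : ∀ k, G k ⟶ X) [∀ k, IsClosedImmersion (j k)] (w : ι → ℕ)
    {K : X.IdealSheafData} (hle : (∏ k ∈ s, (j k).ker ^ w k) ≤ K)
    (hcomap : ∀ k ∈ s, K.comap (j k) = ⊤) : K = ⊤ :=
  eq_top_of_support_subset_of_forall_comap_eq_top s j
    (support_subset_biUnion_range_of_prod_ker_pow_le s j w hle) hcomap

/-- **MULTI-CARRIER END for the FORMAT**: under the same hypotheses, with `I𝒪_X = M · K` and `M` effective Cartier,
`I𝒪_X = M` is locally principal. [cite: GortzWedhorn2020, Def. 13.90] -/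
theorem isLocallyPrincipal_format_of_forall_comap_eq_top {X : Scheme.{u}} {ι : Type v} (s : Finset ι)
    {G : ι → Scheme.{u}} (j : ∀ k, G k ⟶ X) [∀ k, IsClosedImmersion (j k)] (w : ι → ℕ)
    {K M J : X.IdealSheafData} (hM : IsEffectiveCartier M) (hfmt : J = M * K)
    (hle : (∏ k ∈ s, (j k).ker ^ w k) ≤ K) (hcomap : ∀ k ∈ s, K.comap (j k) = ⊤) :
    J = M ∧ IsLocallyPrincipal J := by
  have hK : K = ⊤ := eq_top_of_forall_comap_eq_top s j w hle hcomap
  rw [hK, Scheme.IdealSheafData.mul_top] at hfmt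
  subst hfmt
  exact ⟨rfl, hM.isLocallyPrincipal⟩

end DepthOne

end Summit.ResolutionOfSingularities.ResolutionOfSingularities.Theorems

end
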